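import Literature.NumberTheory.GelbartRogawski1991.PiSCompletionIsThetaTypeTest   -- ★ p840297 the UNSIGNED Test edition (D-b)ᵀ `piSCompletion_isThetaTypeAtCMTest` (binder block copied BYTE-IDENTICALLY below)
import Literature.NumberTheory.Rogawski1990.CharIdentityOnTestFunctionsSigned  -- ★ A-p13 (g28) «QCMT SIGNED»: `CMNonsplitCharIdentityAtTestSigned`, `CMCharIdentityClausesTestSigned`, `CMCharIdentityPackageTestSigned` (the sign token `ε_v(a)`)
import HarnessLib

/-!
# `πˢ(ξ_v)` IS the `U(1)`-theta type — TEST-FUNCTION EDITION, SIGNED at the frame multiplier: `piSCompletion_isThetaTypeAtCMTestSigned` (statement only)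

Gelbart–Rogawski, Invent. Math. 105 (1991), Lem. 5.1.2 with Thm. 5.1.1 (pp. 465–466); Rogawski (1992) Thm. 1.1; Rogawski, Ann. of Math. Stud. 123 (1990), Prop. 13.1.3 (d),
Prop. 13.1.4 p. 199, §4.9 p. 55 (transfer-factor normalisation).  Cell `hodgecm-mathlib` (D-0151), crux H413 = stmt-HodgeConjecture-24833, FLOOR 0 line LH10 «(D-b)ᵀ»
(director SEATPLAN-GO500 §1B; desk F0P3-plan (g13) 2026-09-02T01:57:23Z); typed by LH10-plan (g0) on F0P2-ref1 (g10) r353 OBJECTION ⑧ «D7αᵀ-K2 CURRENCY GAP» (2026-09-02T02:29:59Z)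
and LEAD F0P3a-plan RULING «K» (T9-5, 2026-09-01T08:25Z; ★ `CharIdentityOnTestFunctionsSigned`).

WHY A SIGNED EDITION.  ★ `piSCompletion_isThetaTypeAtCMTest` (p840297, unchanged — kept; it is print-true at PRINT's factor `Δ_v`) concludes the (13.1.4) identity on test functions
with member traces `f ↦ tr c(f dν_G)`.  The tree's finite transfer factor OF RECORD is `Δ‴_v = finExplicitCollection …` (closer `Kit.comparisonKit`), and at a non-split `v` with frame
`ᵗσT·H_v·T = a·Φ₃` it differs from print's `Δ_v` transported by the frame by the sign `ε_v(a) = ω_{L_w∕L⁺_v}(a) ∈ {±1}` (RULING «K»: for `Δ‴_v`-matching test pairs print's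
Prop. 13.1.4 reads `χ_ξ(f^H) = ε_v(a)·(tr πⁿ(f) + tr πˢ(f))`; ★ `CMCharIdentityClausesTestSigned`).  Consequently the UNSIGNED (D-b)ᵀ instantiated AT `Δ‴` would, when `ε_v(a) = −1`,
demand a class `πθ` with `tr πθ = −2·tr πⁿ∘e − tr πˢ` on `C_c^∞(U(H)(L⁺_v))` — impossible by linear independence of characters of inequivalent irreducibles (★
`IrrClass.linearIndependent_smoothTrace`) as soon as test-function transfer at `(Δ‴_v, m_H, m_G)` is surjective enough (H₇) and `ν_G` is a Haar measure (F0P2-ref1 r353 (A)).  The closer's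
rung-0 record carries the SIGNED package (`Rung0Choice.hQ : CMCharIdentityPackageTestSigned … 𝔨.Δ 𝔨.mH mG₀`), so the (D-b) letter consumed at the record must be SIGNED too.  This edition
is ★ p840297's TEXT with EXACTLY ONE token changed at its two sites (the `def` body and its `Iff.rfl` unfolding): the member-trace functional
`fun c f => c.smoothTrace (νG v) f ↦ fun c f => ε_v(a) * c.smoothTrace (νG v) f`, `ε_v(a) := if ∃ z : L_w, IsUnit z ∧ a = z·σ(z) then 1 else −1` — the token of ★
`CMCharIdentityClausesTestSigned` verbatim (same `open scoped Classical` decidability).  Binder block byte-identical to ★ p840297's (hence to ★ `CMThetaDockingClauses`'s).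
So `piSCompletion_isThetaTypeAtCMTestSigned` says: for the global transfer data, Haar families, `ξ`, `μω`, `ξloc` and a rational theta frame — for every pair `(μ, χ_f)` on letter #76's two
dictionary equations, every NON-SPLIT finite `v`, every form congruence `e = e(T, a)`, every Haar `μZ`, every Keys-labelled pair `(π², πⁿ)` with `πⁿ` not square-integrable — SOME line
class `ε` and SOME class `πθ` of `U(H)(L⁺_v)` complete `πⁿ ∘ e` in the identity (13.1.4) ON TEST FUNCTIONS WITH MEMBER TRACES SCALED BY `ε_v(a)`, and `πθ` is the theta type
`X_v(μ, ε, χ_f) ∘ κ_v⁻¹` (★ `ThetaTypeAtCM`) — «`πˢ(ξ_v)` is the supercuspidal Weil representation of the other line class» [GR91 Lem. 5.1.2 p. 466].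
PRINT-TRUE ONLY AT THE TRANSFER DATA OF RECORD: consumers must BIND `(Δ, mH, mG, νH, νG, ξloc)` inside a joint hypothesis with the SIGNED character-identity package
(`CMCharIdentityPackageTestSigned … Δ mH mG`), test-function transfer existence (H₇) and Haar `ν_G` — never ∀-close this predicate over them (at the junk datum `(Δ, mH, mG, νH) = 0` every
pair matches and (13.1.4) is refutable; F0P2-ref1 r235, r352 (ii), r353 (E)).  The printed proof is GLOBAL (Howe–Piatetski-Shapiro theta lift from `U(1)` [GR91 §3.4, Thm. 3.4 (a)],
the dictionary (5.1.1), and the rigidity of `Π(ξ)` [Rogawski1990 Thm. 13.3.6 (c)]); the in-house paydown is the LH10 line `Cruxes/H413/Lines/F0_P3c_DbTPaydown.lean`.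
STATEMENT ONLY: one `def … : Prop` with body + its `Iff.rfl` unfolding; no instance, no notation, no `sorry`; nothing is asserted.
Consumers: P2's SIGNED rows adapter `stubD7αMemDockPerMeasureT_of_rowsSigned` (F0P2-ref1 r353 (C) B2) feeding ★ `F0P2oD7alphaMemDockOfRowsT` at the closer's record tuple; the LH10 head
`DbTS_of_organs`.

* `piSCompletion_isThetaTypeAtCMTestSigned` — the named fact (D-b)ᵀˢ; `piSCompletion_isThetaTypeAtCMTestSigned_iff` — its unfolding (`Iff.rfl`).

## References
* [GelbartRogawski1991] S. Gelbart, J. Rogawski, Invent. Math. 105 (1991): §3.4 Prop. 3.4.1 pp. 459–460, Thm. 3.4 (a) p. 461; §5.1 (5.1.1), Thm. 5.1.1 p. 465, Lem. 5.1.2 p. 466;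
  Remark pp. 466–467.
* [Rogawski1992] J. Rogawski, *The multiplicity formula for A-packets*, in: The zeta functions of Picard modular surfaces, CRM Montréal (1992) 395–419: Thm. 1.1 p. 396.
* [Rogawski1990] J. Rogawski, Ann. of Math. Stud. 123 (1990): §13.1 Prop. 13.1.3 (d), Prop. 13.1.4 p. 199; §4.3 p. 43; §4.9 p. 55; §13.3 Thm. 13.3.6 (c) pp. 201–203.
* [LanglandsShelstad1987] R. Langlands, D. Shelstad, Math. Ann. 278 (1987): §1 (normalisation of transfer factors).
-/

noncomputable section

open NumberField IsDedekindDomain MeasureTheory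
open scoped Matrix ComplexOrder

namespace Literature.NumberTheory.GelbartRogawski1991

open Literature.NumberTheory Literature.NumberTheory.Automorphic Literature.NumberTheory.Automorphic.UnitaryGroup
open Literature.NumberTheory.Automorphic.IdeleClassGroup
open Literature.NumberTheory.Automorphic.Liu2021 Literature.NumberTheory.Automorphic.Liu2021.Def411WeilCarriers
open Literature.NumberTheory.GaloisRepresentations
open Literature.NumberTheory.Rogawski1990

variable (L : Type) [Field L] [NumberField L] [IsCMField L] (H : Matrix (Fin 3) (Fin 3) L)

open scoped Classical in
/-- **(D-b)ᵀˢ — TEST-FUNCTION EDITION, SIGNED: `πˢ(ξ_v)` IS THE THETA TYPE OF THE OTHER LINE CLASS** [GelbartRogawski1991 Lem. 5.1.2 + Thm. 5.1.1; Rogawski1992 Thm. 1.1;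
Rogawski1990 Prop. 13.1.3 (d), Prop. 13.1.4, §4.9], on GIVEN global transfer data (the binders of ★ `piSCompletion_isThetaTypeAtCMTest`, byte-identical, same order): for every pair
`(μ, χ_f)` on the two dictionary equations, every finite `v` of `L⁺` non-split in `L`, every form congruence `ᵗT̄·H_v·T = a·Φ₃`, every Haar measure `μZ` on `U(Φ₃)(L⁺_v) ⧸ Z` and
every Keys-labelled pair `(π², πⁿ)` with `πⁿ` not square-integrable, THERE IS a line class `ε` and a class `πθ` of `U(H)(L⁺_v)` such that the packet `⟨πⁿ ∘ e, some πθ⟩` satisfies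
the character identity (13.1.4) ON TEST FUNCTIONS with member traces `f ↦ ε_v(a)·tr c(f dν_G)`, `ε_v(a) = ω_{L_w∕L⁺_v}(a)` the quadratic character of the frame multiplier (the sign
by which the tree's factor of record `Δ‴_v` differs from print's; ★ `CMNonsplitCharIdentityAtTestSigned`), AND `πθ` is the theta type `X_v(μ, ε, χ_f) ∘ κ_v⁻¹` — «the trace-pinned
`πˢ(ξ_v)` of the (13.1.4)-completion is the `U(1)`-theta type».  PRINT, GLOBAL proof.  A predicate on the data, print-true at the transfer data of record — to be asserted only
inside a joint hypothesis with `CMCharIdentityPackageTestSigned … Δ mH mG`, test-function transfer existence and Haar `ν_G`, never free-standing (at the junk datum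
`(Δ, mH, mG, νH) = 0` every pair matches and the identity is refutable; F0P2-ref1 r235 ∕ r353 (E)).
[cite: GelbartRogawski1991, Lem. 5.1.2 p. 466; Thm. 5.1.1 p. 465; Thm. 3.4 (a) p. 461] [cite: Rogawski1992, Thm. 1.1 p. 396]
[cite: Rogawski1990, §13.1 Prop. 13.1.3 (d), Prop. 13.1.4 p. 199; §4.9 p. 55; §13.3 Thm. 13.3.6 (c) p. 201] [cite: LanglandsShelstad1987, §1] -/
def piSCompletion_isThetaTypeAtCMTestSigned
    [∀ v : HeightOneSpectrum (𝓞 ↥(maximalRealSubfield L)), MeasurableSpace ((cmDatum L 3 H).Local v)]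
    [∀ v : HeightOneSpectrum (𝓞 ↥(maximalRealSubfield L)),
      MeasurableSpace ((cmDatum L 2 (Matrix.of fun i j : Fin 2 => if i.val + j.val + 1 = 2 then (1 : L) else 0)).Local v ×
        (cmDatum L 1 (Matrix.of fun i j : Fin 1 => if i.val + j.val + 1 = 1 then (1 : L) else 0)).Local v)]
    [∀ (v : HeightOneSpectrum (𝓞 ↥(maximalRealSubfield L)))
        (a : ((cmDatum L 2 (Matrix.of fun i j : Fin 2 => if i.val + j.val + 1 = 2 then (1 : L) else 0)).Local v ×
          (cmDatum L 1 (Matrix.of fun i j : Fin 1 => if i.val + j.val + 1 = 1 then (1 : L) else 0)).Local v)),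
      MeasurableSpace (((cmDatum L 2 (Matrix.of fun i j : Fin 2 => if i.val + j.val + 1 = 2 then (1 : L) else 0)).Local v ×
          (cmDatum L 1 (Matrix.of fun i j : Fin 1 => if i.val + j.val + 1 = 1 then (1 : L) else 0)).Local v) ⧸
        Subgroup.centralizer ({a} : Set ((cmDatum L 2 (Matrix.of fun i j : Fin 2 => if i.val + j.val + 1 = 2 then (1 : L) else 0)).Local v ×
          (cmDatum L 1 (Matrix.of fun i j : Fin 1 => if i.val + j.val + 1 = 1 then (1 : L) else 0)).Local v)))]
    [∀ (v : HeightOneSpectrum (𝓞 ↥(maximalRealSubfield L))) (γ : (cmDatum L 3 H).Local v),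
      MeasurableSpace ((cmDatum L 3 H).Local v ⧸ Subgroup.centralizer ({γ} : Set ((cmDatum L 3 H).Local v)))]
    (Δ : ∀ v : HeightOneSpectrum (𝓞 ↥(maximalRealSubfield L)), LocalTransferFactor L H v)
    (mH : ∀ v : HeightOneSpectrum (𝓞 ↥(maximalRealSubfield L)),
      OrbitalMeasureFamily ((cmDatum L 2 (Matrix.of fun i j : Fin 2 => if i.val + j.val + 1 = 2 then (1 : L) else 0)).Local v ×
        (cmDatum L 1 (Matrix.of fun i j : Fin 1 => if i.val + j.val + 1 = 1 then (1 : L) else 0)).Local v))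
    (mG : ∀ v : HeightOneSpectrum (𝓞 ↥(maximalRealSubfield L)), OrbitalMeasureFamily ((cmDatum L 3 H).Local v))
    (νH : ∀ v : HeightOneSpectrum (𝓞 ↥(maximalRealSubfield L)),
      Measure ((cmDatum L 2 (Matrix.of fun i j : Fin 2 => if i.val + j.val + 1 = 2 then (1 : L) else 0)).Local v ×
        (cmDatum L 1 (Matrix.of fun i j : Fin 1 => if i.val + j.val + 1 = 1 then (1 : L) else 0)).Local v))
    (νG : ∀ v : HeightOneSpectrum (𝓞 ↥(maximalRealSubfield L)), Measure ((cmDatum L 3 H).Local v))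
    (ξ : OneDimAutRepH L) (μω : HeckeCharacter L)
    (ξloc : ∀ v : HeightOneSpectrum (𝓞 ↥(maximalRealSubfield L)),
      (cmDatum L 2 (Matrix.of fun i j : Fin 2 => if i.val + j.val + 1 = 2 then (1 : L) else 0)).Local v ×
        (cmDatum L 1 (Matrix.of fun i j : Fin 1 => if i.val + j.val + 1 = 1 then (1 : L) else 0)).Local v →* ℂˣ)
    {n' : ℕ} (e₁ : Fin 3 × Fin 1 ≃ Fin n') (dV : Fin 3 → L) (hdV : ∀ i, IsCMField.complexConj L (dV i) = dV i) (hdV0 : ∀ i, dV i ≠ 0) (g : GL (Fin 3) L)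
    (hg : ((g : Matrix (Fin 3) (Fin 3) L).map (cmConjRingHom L))ᵀ * H * (g : Matrix (Fin 3) (Fin 3) L) = Matrix.diagonal dV) : Prop :=
    ∀ (μ : Literature.NumberTheory.Automorphic.IdeleClassGroup L →ₜ* Circle) (hμ : IsConjugateSymplectic L μ)
    (χf : UnitaryGroup.finAdelicOne (↥(maximalRealSubfield L)) L (IsCMField.complexConj L) →* ℂˣ),
    Continuous χf → (∀ z, ‖((χf z : ℂˣ) : ℂ)‖ = 1) →
    (∀ v : HeightOneSpectrum (𝓞 ↥(maximalRealSubfield L)),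
        (toHeckeCharacter L μ).semilocalComponent L v = (ξ.bcη⁻¹ * ξ.bcψ⁻¹ * μω).semilocalComponent L v) →
    (∀ z : (FiniteAdeleRing (𝓞 L) L)ˣ,
        χf (finAdelicCheck (↥(maximalRealSubfield L)) L (IsCMField.complexConj L)
            (AlgEquiv.ext fun x => by rw [AlgEquiv.mul_apply, IsCMField.complexConj_apply_apply, AlgEquiv.one_apply]) z) =
          (ξ.bcψ⁻¹ * (ξ.bcη⁻¹ * ξ.bcψ⁻¹ * μω) ^ 2)
            (Units.map (N := AdeleRing (𝓞 L) L) (MonoidHom.inr (InfiniteAdeleRing L) (FiniteAdeleRing (𝓞 L) L)) z)) →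
    ∀ (v : HeightOneSpectrum (𝓞 ↥(maximalRealSubfield L))),
      (∀ w : PlacesOver L v, IsCMField.complexConj L • w.1 = w.1) →
      ∀ (T : GL (Fin 3) (LocalRing L v)) (a : LocalRing L v) (ha : IsUnit a)
        (h : formCongr (conjLocal L (IsCMField.complexConj L) v) T (H.map (algebraMap L (LocalRing L v))) =
          a • (Matrix.of fun i j : Fin 3 => if i.val + j.val + 1 = 3 then (1 : L) else 0).map (algebraMap L (LocalRing L v))),
      ∀ [MeasurableSpace (Gqs L v ⧸ Subgroup.center (Gqs L v))] [BorelSpace (Gqs L v ⧸ Subgroup.center (Gqs L v))]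
        (μZ : Measure (Gqs L v ⧸ Subgroup.center (Gqs L v))) [μZ.IsHaarMeasure],
      ∀ (π2 πn : IrrClass (Gqs L v)),
        KeysCaseTwoLabels L v (μω.semilocalComponent L v) (torusLocalComponent L (IsCMField.complexConj L) v ξ.η)
          (torusLocalComponent L (IsCMField.complexConj L) v ξ.ψ) π2 πn →
        ¬ πn.IsSquareIntegrable μZ →
        ∃ (ε : (↥(maximalRealSubfield L))ˣ) (πθ : IrrClass ((cmDatum L 3 H).Local v)),
          (⟨IrrClass.comap (cmDatumLocalCongr L v T ha h).symm πn, some πθ⟩ : CMLocalAPacket L H v).CharIdentityAtTest L H v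
              (fun c f => (if ∃ z : LocalRing L v, IsUnit z ∧ a = z * conjLocal L (IsCMField.complexConj L) v z then (1 : ℂ) else -1) * c.smoothTrace (νG v) f) (ξloc v) (νH v) (Δ v) (mH v) (mG v) ∧
            ThetaTypeAtCM L H e₁ dV hdV hdV0 g hg μ hμ χf ε v πθ


open scoped Classical in
/-- Unfolding of `piSCompletion_isThetaTypeAtCMTestSigned` (definitional). [cite: GelbartRogawski1991, Lem. 5.1.2 p. 466] [cite: Rogawski1990, §13.1 Prop. 13.1.4 p. 199; §4.9 p. 55] -/
theorem piSCompletion_isThetaTypeAtCMTestSigned_iff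
    [∀ v : HeightOneSpectrum (𝓞 ↥(maximalRealSubfield L)), MeasurableSpace ((cmDatum L 3 H).Local v)]
    [∀ v : HeightOneSpectrum (𝓞 ↥(maximalRealSubfield L)),
      MeasurableSpace ((cmDatum L 2 (Matrix.of fun i j : Fin 2 => if i.val + j.val + 1 = 2 then (1 : L) else 0)).Local v ×
        (cmDatum L 1 (Matrix.of fun i j : Fin 1 => if i.val + j.val + 1 = 1 then (1 : L) else 0)).Local v)]
    [∀ (v : HeightOneSpectrum (𝓞 ↥(maximalRealSubfield L)))
        (a : ((cmDatum L 2 (Matrix.of fun i j : Fin 2 => if i.val + j.val + 1 = 2 then (1 : L) else 0)).Local v ×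
          (cmDatum L 1 (Matrix.of fun i j : Fin 1 => if i.val + j.val + 1 = 1 then (1 : L) else 0)).Local v)),
      MeasurableSpace (((cmDatum L 2 (Matrix.of fun i j : Fin 2 => if i.val + j.val + 1 = 2 then (1 : L) else 0)).Local v ×
          (cmDatum L 1 (Matrix.of fun i j : Fin 1 => if i.val + j.val + 1 = 1 then (1 : L) else 0)).Local v) ⧸
        Subgroup.centralizer ({a} : Set ((cmDatum L 2 (Matrix.of fun i j : Fin 2 => if i.val + j.val + 1 = 2 then (1 : L) else 0)).Local v ×
          (cmDatum L 1 (Matrix.of fun i j : Fin 1 => if i.val + j.val + 1 = 1 then (1 : L) else 0)).Local v)))]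
    [∀ (v : HeightOneSpectrum (𝓞 ↥(maximalRealSubfield L))) (γ : (cmDatum L 3 H).Local v),
      MeasurableSpace ((cmDatum L 3 H).Local v ⧸ Subgroup.centralizer ({γ} : Set ((cmDatum L 3 H).Local v)))]
    (Δ : ∀ v : HeightOneSpectrum (𝓞 ↥(maximalRealSubfield L)), LocalTransferFactor L H v)
    (mH : ∀ v : HeightOneSpectrum (𝓞 ↥(maximalRealSubfield L)),
      OrbitalMeasureFamily ((cmDatum L 2 (Matrix.of fun i j : Fin 2 => if i.val + j.val + 1 = 2 then (1 : L) else 0)).Local v ×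
        (cmDatum L 1 (Matrix.of fun i j : Fin 1 => if i.val + j.val + 1 = 1 then (1 : L) else 0)).Local v))
    (mG : ∀ v : HeightOneSpectrum (𝓞 ↥(maximalRealSubfield L)), OrbitalMeasureFamily ((cmDatum L 3 H).Local v))
    (νH : ∀ v : HeightOneSpectrum (𝓞 ↥(maximalRealSubfield L)),
      Measure ((cmDatum L 2 (Matrix.of fun i j : Fin 2 => if i.val + j.val + 1 = 2 then (1 : L) else 0)).Local v ×
        (cmDatum L 1 (Matrix.of fun i j : Fin 1 => if i.val + j.val + 1 = 1 then (1 : L) else 0)).Local v))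
    (νG : ∀ v : HeightOneSpectrum (𝓞 ↥(maximalRealSubfield L)), Measure ((cmDatum L 3 H).Local v))
    (ξ : OneDimAutRepH L) (μω : HeckeCharacter L)
    (ξloc : ∀ v : HeightOneSpectrum (𝓞 ↥(maximalRealSubfield L)),
      (cmDatum L 2 (Matrix.of fun i j : Fin 2 => if i.val + j.val + 1 = 2 then (1 : L) else 0)).Local v ×
        (cmDatum L 1 (Matrix.of fun i j : Fin 1 => if i.val + j.val + 1 = 1 then (1 : L) else 0)).Local v →* ℂˣ)
    {n' : ℕ} (e₁ : Fin 3 × Fin 1 ≃ Fin n') (dV : Fin 3 → L) (hdV : ∀ i, IsCMField.complexConj L (dV i) = dV i) (hdV0 : ∀ i, dV i ≠ 0) (g : GL (Fin 3) L)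
    (hg : ((g : Matrix (Fin 3) (Fin 3) L).map (cmConjRingHom L))ᵀ * H * (g : Matrix (Fin 3) (Fin 3) L) = Matrix.diagonal dV) :
    piSCompletion_isThetaTypeAtCMTestSigned L H Δ mH mG νH νG ξ μω ξloc e₁ dV hdV hdV0 g hg ↔
    (  ∀ (μ : Literature.NumberTheory.Automorphic.IdeleClassGroup L →ₜ* Circle) (hμ : IsConjugateSymplectic L μ)
        (χf : UnitaryGroup.finAdelicOne (↥(maximalRealSubfield L)) L (IsCMField.complexConj L) →* ℂˣ),
        Continuous χf → (∀ z, ‖((χf z : ℂˣ) : ℂ)‖ = 1) →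
        (∀ v : HeightOneSpectrum (𝓞 ↥(maximalRealSubfield L)),
            (toHeckeCharacter L μ).semilocalComponent L v = (ξ.bcη⁻¹ * ξ.bcψ⁻¹ * μω).semilocalComponent L v) →
        (∀ z : (FiniteAdeleRing (𝓞 L) L)ˣ,
            χf (finAdelicCheck (↥(maximalRealSubfield L)) L (IsCMField.complexConj L)
                (AlgEquiv.ext fun x => by rw [AlgEquiv.mul_apply, IsCMField.complexConj_apply_apply, AlgEquiv.one_apply]) z) =
              (ξ.bcψ⁻¹ * (ξ.bcη⁻¹ * ξ.bcψ⁻¹ * μω) ^ 2)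
                (Units.map (N := AdeleRing (𝓞 L) L) (MonoidHom.inr (InfiniteAdeleRing L) (FiniteAdeleRing (𝓞 L) L)) z)) →
        ∀ (v : HeightOneSpectrum (𝓞 ↥(maximalRealSubfield L))),
          (∀ w : PlacesOver L v, IsCMField.complexConj L • w.1 = w.1) →
          ∀ (T : GL (Fin 3) (LocalRing L v)) (a : LocalRing L v) (ha : IsUnit a)
            (h : formCongr (conjLocal L (IsCMField.complexConj L) v) T (H.map (algebraMap L (LocalRing L v))) =
              a • (Matrix.of fun i j : Fin 3 => if i.val + j.val + 1 = 3 then (1 : L) else 0).map (algebraMap L (LocalRing L v))),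
          ∀ [MeasurableSpace (Gqs L v ⧸ Subgroup.center (Gqs L v))] [BorelSpace (Gqs L v ⧸ Subgroup.center (Gqs L v))]
            (μZ : Measure (Gqs L v ⧸ Subgroup.center (Gqs L v))) [μZ.IsHaarMeasure],
          ∀ (π2 πn : IrrClass (Gqs L v)),
            KeysCaseTwoLabels L v (μω.semilocalComponent L v) (torusLocalComponent L (IsCMField.complexConj L) v ξ.η)
              (torusLocalComponent L (IsCMField.complexConj L) v ξ.ψ) π2 πn →
            ¬ πn.IsSquareIntegrable μZ →
            ∃ (ε : (↥(maximalRealSubfield L))ˣ) (πθ : IrrClass ((cmDatum L 3 H).Local v)),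
              (⟨IrrClass.comap (cmDatumLocalCongr L v T ha h).symm πn, some πθ⟩ : CMLocalAPacket L H v).CharIdentityAtTest L H v
                  (fun c f => (if ∃ z : LocalRing L v, IsUnit z ∧ a = z * conjLocal L (IsCMField.complexConj L) v z then (1 : ℂ) else -1) * c.smoothTrace (νG v) f) (ξloc v) (νH v) (Δ v) (mH v) (mG v) ∧
                ThetaTypeAtCM L H e₁ dV hdV hdV0 g hg μ hμ χf ε v πθ) :=
  Iff.rfl

end Literature.NumberTheory.GelbartRogawski1991

end
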